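import Summits.Schanuel.Schanuel.Theorems.DiophantineDichotomyKhovanskiiApproxTypeEvRareFieldDefs

/-! Sketch for crux idea `order-defect-certificates` (strategist, lens transfer+negation, aimed at LEAF 1
`LWLayerRankThreeUp`): the typed missing input M2 and its first (bookkeeping) lemma, as SIGNATURES. -/

noncomputable section
set_option linter.dupNamespace false

namespace Summit.Schanuel.Schanuel.Cruxes.KhovanskiiApproxTypeEv.OrderDefect

open Summit.Schanuel.Schanuel.Cruxes.KhovanskiiApproxTypeEv.AnchoredReduction (ApproxTypeEvAt)

/-- **M2 `OrderDefectMeasure n κ`** — an EVENTUAL transcendence measure, in the degree aspect `D^κ`, for the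
value `η = Σ_j e^{β_j}` of the order-`n` exponential sum at `ℚ`-linearly independent algebraic frequencies:
`∃ C > 0 ∀ D ∃ H₀ ∀ H ≥ H₀ ∀ P ∈ ℤ[x]∖0, deg P ≤ D, ‖P‖_∞ ≤ H : |P(η)| ≥ exp(−C · D^κ · log H)`.
KNOWN with `κ = n` (Lang–Galochkin / Ably 1994 at `m = n` applied to `P ∘ (x₁ + ⋯ + xₙ)`, penalty absorbed by
`H₀(D)`); Dirichlet forbids `κ < 1`; leaf 1 at rank `n` needs `κ < n − 1/2` against the `S_k`-sum species
(STRATEGY-CENSUS §7).  Signs/coefficients `ε_j ∈ {±1}` are absorbed by replacing `β_j` with `β_j + iπ`. -/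
def OrderDefectMeasure (n : ℕ) (κ : ℝ) : Prop :=
  ∀ β : Fin n → ℂ, (∀ j, IsAlgebraic ℚ (β j)) → LinearIndependent ℚ β →
    ∃ C : ℝ, 0 < C ∧ ∀ D : ℕ, ∃ H₀ : ℕ, ∀ (H : ℕ) (P : Polynomial ℤ), H₀ ≤ H → P ≠ 0 →
      P.natDegree ≤ D → (∀ k, |P.coeff k| ≤ (H : ℤ)) →
        Real.exp (-(C * (D : ℝ) ^ κ * Real.log H)) ≤ ‖Polynomial.aeval (∑ j, Complex.exp (β j)) P‖

/-- **First lemma (bookkeeping, provable now; the analogue of `abelianChallengers_repelled_of`)** — the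
LINEAR-FORM CERTIFICATE: at an LW point `θ = (s, e^s)`, a challenger whose `y`-coordinates sum EXACTLY to an
algebraic number `ϑ` (root of a non-zero integer polynomial of degree `≤ D` and height `≤ H`) stays at distance
`≥ exp(−C D^κ log H) / (n · (D+1) · H · (2 + ‖e^s‖)^D)` — mean value theorem for `P` between
`η = Σ e^{s_j}` and `ϑ = Σ γ_y(j)`, `|P(η)| = |P(η) − P(ϑ)|`, and M2.  (The `S_k`-sum species of §7 has
`Σ_j ± α_j = 2θ_a` with `θ_a` of degree `k = d^{1/3}`.) -/
def LinearFormCertificate (n : ℕ) (κ : ℝ) : Prop :=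
  ∀ s : Fin n → ℂ, (∀ j, IsAlgebraic ℚ (s j)) → LinearIndependent ℚ s →
    ∃ C : ℝ, 0 < C ∧ ∀ D : ℕ, ∃ H₀ : ℕ, ∀ (H : ℕ) (γ : Fin n ⊕ Fin n → ℂ) (P : Polynomial ℤ),
      H₀ ≤ H → P ≠ 0 → P.natDegree ≤ D → (∀ k, |P.coeff k| ≤ (H : ℤ)) →
      Polynomial.aeval (∑ j, γ (Sum.inr j)) P = 0 → ‖γ - Sum.elim s (Complex.exp ∘ s)‖ ≤ 1 →
        Real.exp (-(C * (D : ℝ) ^ κ * Real.log H)) /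
            (n * (D + 1) * H * (2 + ‖Complex.exp ∘ s‖) ^ D)
          ≤ ‖γ - Sum.elim s (Complex.exp ∘ s)‖

/-- First lemma of the line-to-be on leaf 1 (signature only here): M2 gives the linear-form certificate. -/
theorem linearFormCertificate_of (n : ℕ) (κ : ℝ) :
    OrderDefectMeasure n κ → LinearFormCertificate n κ := by
  sorry

end Summit.Schanuel.Schanuel.Cruxes.KhovanskiiApproxTypeEv.OrderDefect
end
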